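import Summits.MatrixMultiplication.MatrixMultiplication.Theorems.EdgePencilMaxFaces
import HarnessLib

/-!
# Extremal sights on the two faces of the pencil: `DMaxBlind ⟺ max_{F[D]} p = 0`,
# `MidTight ⟺ max_{F[D]} p = T − ψ ⟺ min_{F[T]} p ≤ T − ψ`, the leaf `⟺ min_{F[T]} p = 0`

Support kernel for `stmt-MatrixMultiplication-26697` (`TetraExcessZero : ω(K₄) ≤ ω(2,1,2) =: ψ`, route
`TetrahedronCarving`; cut of record `closes (TetraExcessZero) (TetraPlusTwo) : ω = 2`, UNCHANGED; lineage
`decomp-mm-lens-6`, generation 46; sequel of `EdgePencilMaxFaces`). No item is added or changed; no definition is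
introduced. Notation as there: `X₄(F) = DTensorClass.asymptoticSpectrumDTensors F 2`, `R̃ = asympRankOf (· ≤ ·)`,
`[t] = DTensorClass.mk t`, `D_n = sixTetra F n 1`, `T(K₄)_n = tetra F n`, `P_2 = (i ↦ [i 0 = i 1])` on
`Fin 4 → Fin 2`, `χ(δ) = omegaSix F δ`, `ψ = ω(2,1,2)`, `T = ω(K₄)`, `p_φ = log₂ φ[P_2]` (the SIGHT of `φ`),
`d_φ = log₂ φ[D_2]`; the faces `F[D_2] = X₄ ∩ {φ | φ[D_2] = R̃[D_2]}` (`⟺ d_φ = ψ`) and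
`F[T(K₄)_2] = X₄ ∩ {φ | φ[T(K₄)_2] = R̃[T(K₄)_2]}` (`⟺ p_φ + d_φ = T`), spelled out inline; `DMaxBlind` and
`MidTight` inline as in `EdgePencilBimaximal`.

§39 EXTREMAL SIGHTS. On the compact, non-empty faces (`EdgePencilMaxFaces.isCompact_maxFace`,
`maxFace_nonempty`) the continuous sight `φ ↦ φ[P_2]` attains its MAXIMUM on `F[D_2]`
(`exists_isMaxOn_pair_diamondFace`) and its MINIMUM on `F[T(K₄)_2]` (`exists_isMinOn_pair_tetraFace`); the
bracket `p_φ ≤ T − ψ ≤ p_{φ'}` for `φ ∈ F[D_2]`, `φ' ∈ F[T(K₄)_2]` (`excess_le_coord_pair_of_tetra_max`,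
`coord_pair_dFace_le_excess_le_coord_pair_tFace`). At a maximiser `φ₀` of the sight on `F[D_2]`:
`DMaxBlind ⟺ p_{φ₀} = 0` (`dMaxBlind_iff_maxSight_eq_zero`) and `MidTight ⟺ p_{φ₀} = T − ψ`
(`midTight_iff_maxSight_eq_excess`). Dually, at a minimiser `φ₁` of the sight on `F[T(K₄)_2]`:
`MidTight ⟺ p_{φ₁} ≤ T − ψ` (`midTight_iff_exists_tetraMax_sight_le_excess`, `midTight_iff_minSight_le_excess`)
and the leaf `T ≤ ψ ⟺ p_{φ₁} = 0` (`excessZero_iff_minSight_eq_zero`); every tetrahedron-maximal point props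
the ladder from the TOP end, `T − (1 − log_n e)·p_φ ≤ χ(log_n e)` (`omegaTetra_sub_le_omegaSix_of_tetraMax`), so
`p_{φ₁}` is the best top-end support slope available from `F[T(K₄)_2]`. Reading for the line `blind_and_chord`
(`stub_dMaxBlind`, `stub_midTight`): both stubs are values of ONE continuous function (the sight) at extremal
points of two compact faces — `max_{F[D]} p = 0` (blind) and `max_{F[D]} p = T − ψ = min_{F[T]} p` (chord) — and
the crux `T ≤ ψ` is `min_{F[T]} p = 0`.

References: Strassen 1988, Thm. 3.8 [Strassen1988]; Zuiddam 2018, Cor. 2.13, Thm. 2.15 [Zuiddam2018];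
Christandl–Vrana–Zuiddam 2023, Prop. 1.6 [ChristandlVranaZuiddam2023]; Lotti–Romani 1983, §2 [LottiRomani1983].
No `sorry`, no new axiom, no instance, no notation, no definition.
-/

noncomputable section

set_option linter.dupNamespace false

open Filter Finset Literature.Computability.AlgebraicComplexity
open Summit.MatrixMultiplication.MatrixMultiplication.Theorems.TetrahedronTensor
open Summit.MatrixMultiplication.MatrixMultiplication.Theorems.TetraDiagonal
open Summit.MatrixMultiplication.MatrixMultiplication.Theses.TetrahedronCarving

namespace Summit.MatrixMultiplication.MatrixMultiplication.Theorems.EdgePencil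

/-! ## §39 Extremal sights on the two faces -/

section Sights

variable (F : Type) [Field F]

/-- **The sight attains its MAXIMUM on the diamond face** `F[D_2]` (compact, non-empty; `φ ↦ φ[P_2]` continuous).
[cite: Zuiddam2018, Thm. 2.15] -/
theorem exists_isMaxOn_pair_diamondFace :
    ∃ φ₀ ∈ DTensorClass.asymptoticSpectrumDTensors F 2 ∩
        {φ | φ (DTensorClass.mk (sixTetra F 2 1)) =
          asympRankOf (fun x y : DTensorClass F 4 => x ≤ y) (DTensorClass.mk (sixTetra F 2 1))},
      IsMaxOn (fun φ : DTensorClass F 4 → ℝ => φ (DTensorClass.mk (fun i : Fin 4 → Fin 2 => (ind (i 0 = i 1) : F))))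
        (DTensorClass.asymptoticSpectrumDTensors F 2 ∩
          {φ | φ (DTensorClass.mk (sixTetra F 2 1)) =
            asympRankOf (fun x y : DTensorClass F 4 => x ≤ y) (DTensorClass.mk (sixTetra F 2 1))}) φ₀ :=
  (isCompact_maxFace _).exists_isMaxOn (maxFace_nonempty _) (continuous_apply _).continuousOn

/-- **The sight attains its MINIMUM on the tetrahedron face** `F[T(K₄)_2]`. [cite: Zuiddam2018, Thm. 2.15] -/
theorem exists_isMinOn_pair_tetraFace :
    ∃ φ₁ ∈ DTensorClass.asymptoticSpectrumDTensors F 2 ∩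
        {φ | φ (DTensorClass.mk (tetra F 2)) =
          asympRankOf (fun x y : DTensorClass F 4 => x ≤ y) (DTensorClass.mk (tetra F 2))},
      IsMinOn (fun φ : DTensorClass F 4 → ℝ => φ (DTensorClass.mk (fun i : Fin 4 → Fin 2 => (ind (i 0 = i 1) : F))))
        (DTensorClass.asymptoticSpectrumDTensors F 2 ∩
          {φ | φ (DTensorClass.mk (tetra F 2)) =
            asympRankOf (fun x y : DTensorClass F 4 => x ≤ y) (DTensorClass.mk (tetra F 2))}) φ₁ :=
  (isCompact_maxFace _).exists_isMinOn (maxFace_nonempty _) (continuous_apply _).continuousOn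

/-- **EXCESS ≤ SIGHT on the tetrahedron face**: `p_φ + d_φ = T ⟹ T − ψ ≤ p_φ` (as `d_φ ≤ ψ`); dual to
`coord_pair_le_excess_of_diamond_max`. [cite: Strassen1988, Thm. 3.8] -/
theorem excess_le_coord_pair_of_tetra_max {φ : DTensorClass F 4 → ℝ}
    (hφ : φ ∈ DTensorClass.asymptoticSpectrumDTensors F 2)
    (hT : Real.logb 2 (φ (DTensorClass.mk (fun i : Fin 4 → Fin 2 => (ind (i 0 = i 1) : F)))) +
      Real.logb 2 (φ (DTensorClass.mk (sixTetra F 2 1))) = omegaTetra F) :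
    omegaTetra F - omegaRect F 2 1 2 ≤
      Real.logb 2 (φ (DTensorClass.mk (fun i : Fin 4 → Fin 2 => (ind (i 0 = i 1) : F)))) := by
  linarith [(coord_diamond_mem F hφ).2]

/-- **THE BRACKET**: `p_φ ≤ T − ψ ≤ p_{φ'}` for `φ` on the diamond face and `φ'` on the tetrahedron face.
[cite: Strassen1988, Thm. 3.8] -/
theorem coord_pair_dFace_le_excess_le_coord_pair_tFace {φ φ' : DTensorClass F 4 → ℝ}
    (hφ : φ ∈ DTensorClass.asymptoticSpectrumDTensors F 2)
    (hD : φ (DTensorClass.mk (sixTetra F 2 1)) =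
      asympRankOf (fun x y : DTensorClass F 4 => x ≤ y) (DTensorClass.mk (sixTetra F 2 1)))
    (hφ' : φ' ∈ DTensorClass.asymptoticSpectrumDTensors F 2)
    (hT : φ' (DTensorClass.mk (tetra F 2)) =
      asympRankOf (fun x y : DTensorClass F 4 => x ≤ y) (DTensorClass.mk (tetra F 2))) :
    Real.logb 2 (φ (DTensorClass.mk (fun i : Fin 4 → Fin 2 => (ind (i 0 = i 1) : F)))) ≤
        omegaTetra F - omegaRect F 2 1 2 ∧
      omegaTetra F - omegaRect F 2 1 2 ≤
        Real.logb 2 (φ' (DTensorClass.mk (fun i : Fin 4 → Fin 2 => (ind (i 0 = i 1) : F)))) :=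
  ⟨coord_pair_le_excess_of_diamond_max F hφ ((spectrum_diamond_eq_asympRank_iff F le_rfl hφ).1 hD),
    excess_le_coord_pair_of_tetra_max F hφ' ((spectrum_tetra_eq_asympRank_iff F le_rfl hφ').1 hT)⟩

/-- **`DMaxBlind ⟺ THE MAXIMAL SIGHT ON THE DIAMOND FACE IS 0`** (at any maximiser `φ₀` of the sight on `F[D_2]`).
[cite: Strassen1988, Thm. 3.8] -/
theorem dMaxBlind_iff_maxSight_eq_zero {φ₀ : DTensorClass F 4 → ℝ}
    (h₀ : φ₀ ∈ DTensorClass.asymptoticSpectrumDTensors F 2 ∩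
      {φ | φ (DTensorClass.mk (sixTetra F 2 1)) =
        asympRankOf (fun x y : DTensorClass F 4 => x ≤ y) (DTensorClass.mk (sixTetra F 2 1))})
    (hmax : IsMaxOn
      (fun φ : DTensorClass F 4 → ℝ => φ (DTensorClass.mk (fun i : Fin 4 → Fin 2 => (ind (i 0 = i 1) : F))))
      (DTensorClass.asymptoticSpectrumDTensors F 2 ∩
        {φ | φ (DTensorClass.mk (sixTetra F 2 1)) =
          asympRankOf (fun x y : DTensorClass F 4 => x ≤ y) (DTensorClass.mk (sixTetra F 2 1))}) φ₀) :
    (∀ φ ∈ DTensorClass.asymptoticSpectrumDTensors F 2,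
      Real.logb 2 (φ (DTensorClass.mk (sixTetra F 2 1))) = omegaRect F 2 1 2 →
        Real.logb 2 (φ (DTensorClass.mk (fun i : Fin 4 → Fin 2 => (ind (i 0 = i 1) : F)))) = 0) ↔
      Real.logb 2 (φ₀ (DTensorClass.mk (fun i : Fin 4 → Fin 2 => (ind (i 0 = i 1) : F)))) = 0 := by
  constructor
  · intro hB
    exact hB φ₀ h₀.1 ((spectrum_diamond_eq_asympRank_iff F le_rfl h₀.1).1 h₀.2)
  · intro hp₀ φ hφ hd
    have hφface : φ ∈ DTensorClass.asymptoticSpectrumDTensors F 2 ∩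
        {φ | φ (DTensorClass.mk (sixTetra F 2 1)) =
          asympRankOf (fun x y : DTensorClass F 4 => x ≤ y) (DTensorClass.mk (sixTetra F 2 1))} :=
      ⟨hφ, (spectrum_diamond_eq_asympRank_iff F le_rfl hφ).2 hd⟩
    have hle : φ (DTensorClass.mk (fun i : Fin 4 → Fin 2 => (ind (i 0 = i 1) : F))) ≤
        φ₀ (DTensorClass.mk (fun i : Fin 4 → Fin 2 => (ind (i 0 = i 1) : F))) := hmax hφface
    have h1 : 1 ≤ φ (DTensorClass.mk (fun i : Fin 4 → Fin 2 => (ind (i 0 = i 1) : F))) :=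
      one_le_spectrum_pair (by norm_num) hφ
    have hlog := Real.logb_le_logb_of_le one_lt_two (by linarith) hle
    rw [hp₀] at hlog
    exact le_antisymm hlog (coord_pair_mem hφ).1

/-- **`MidTight ⟺ THE MAXIMAL SIGHT ON THE DIAMOND FACE IS THE EXCESS `T − ψ`** (at any maximiser `φ₀`).
[cite: Zuiddam2018, Cor. 2.13] -/
theorem midTight_iff_maxSight_eq_excess {φ₀ : DTensorClass F 4 → ℝ}
    (h₀ : φ₀ ∈ DTensorClass.asymptoticSpectrumDTensors F 2 ∩
      {φ | φ (DTensorClass.mk (sixTetra F 2 1)) =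
        asympRankOf (fun x y : DTensorClass F 4 => x ≤ y) (DTensorClass.mk (sixTetra F 2 1))})
    (hmax : IsMaxOn
      (fun φ : DTensorClass F 4 → ℝ => φ (DTensorClass.mk (fun i : Fin 4 → Fin 2 => (ind (i 0 = i 1) : F))))
      (DTensorClass.asymptoticSpectrumDTensors F 2 ∩
        {φ | φ (DTensorClass.mk (sixTetra F 2 1)) =
          asympRankOf (fun x y : DTensorClass F 4 => x ≤ y) (DTensorClass.mk (sixTetra F 2 1))}) φ₀) :
    omegaRect F 2 1 2 + omegaTetra F ≤ 2 * omegaSix F (1 / 2) ↔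
      Real.logb 2 (φ₀ (DTensorClass.mk (fun i : Fin 4 → Fin 2 => (ind (i 0 = i 1) : F)))) =
        omegaTetra F - omegaRect F 2 1 2 := by
  have hd₀ := (spectrum_diamond_eq_asympRank_iff F le_rfl h₀.1).1 h₀.2
  rw [midTight_iff_exists_dMax_sight_eq_excess F]
  constructor
  · rintro ⟨φ, hφ, hd, hp⟩
    have hφface : φ ∈ DTensorClass.asymptoticSpectrumDTensors F 2 ∩
        {φ | φ (DTensorClass.mk (sixTetra F 2 1)) =
          asympRankOf (fun x y : DTensorClass F 4 => x ≤ y) (DTensorClass.mk (sixTetra F 2 1))} :=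
      ⟨hφ, (spectrum_diamond_eq_asympRank_iff F le_rfl hφ).2 hd⟩
    have hle : φ (DTensorClass.mk (fun i : Fin 4 → Fin 2 => (ind (i 0 = i 1) : F))) ≤
        φ₀ (DTensorClass.mk (fun i : Fin 4 → Fin 2 => (ind (i 0 = i 1) : F))) := hmax hφface
    have h1 : 1 ≤ φ (DTensorClass.mk (fun i : Fin 4 → Fin 2 => (ind (i 0 = i 1) : F))) :=
      one_le_spectrum_pair (by norm_num) hφ
    have hlog := Real.logb_le_logb_of_le one_lt_two (by linarith) hle
    exact le_antisymm (coord_pair_le_excess_of_diamond_max F h₀.1 hd₀) (by linarith)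
  · intro hp₀
    exact ⟨φ₀, h₀.1, hd₀, hp₀⟩

/-- **`MidTight ⟺` some tetrahedron-maximal point has SIGHT ≤ EXCESS** (`p_φ + d_φ = T ∧ p_φ ≤ T − ψ`; then
`=` by `excess_le_coord_pair_of_tetra_max`). [cite: Zuiddam2018, Cor. 2.13] -/
theorem midTight_iff_exists_tetraMax_sight_le_excess :
    omegaRect F 2 1 2 + omegaTetra F ≤ 2 * omegaSix F (1 / 2) ↔
      ∃ φ ∈ DTensorClass.asymptoticSpectrumDTensors F 2,
        Real.logb 2 (φ (DTensorClass.mk (fun i : Fin 4 → Fin 2 => (ind (i 0 = i 1) : F)))) +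
            Real.logb 2 (φ (DTensorClass.mk (sixTetra F 2 1))) = omegaTetra F ∧
          Real.logb 2 (φ (DTensorClass.mk (fun i : Fin 4 → Fin 2 => (ind (i 0 = i 1) : F)))) ≤
            omegaTetra F - omegaRect F 2 1 2 := by
  rw [midTight_iff_exists_bimaximal F]
  refine exists_congr fun φ => and_congr_right fun hφ => ?_
  constructor
  · rintro ⟨hd, hsum⟩
    exact ⟨hsum, by linarith⟩
  · rintro ⟨hsum, hp⟩
    exact ⟨by linarith [(coord_diamond_mem F hφ).2], hsum⟩

/-- **`MidTight ⟺ THE MINIMAL SIGHT ON THE TETRAHEDRON FACE IS ≤ T − ψ`** (at any minimiser `φ₁`; then `=`).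
[cite: Zuiddam2018, Cor. 2.13] -/
theorem midTight_iff_minSight_le_excess {φ₁ : DTensorClass F 4 → ℝ}
    (h₁ : φ₁ ∈ DTensorClass.asymptoticSpectrumDTensors F 2 ∩
      {φ | φ (DTensorClass.mk (tetra F 2)) =
        asympRankOf (fun x y : DTensorClass F 4 => x ≤ y) (DTensorClass.mk (tetra F 2))})
    (hmin : IsMinOn
      (fun φ : DTensorClass F 4 → ℝ => φ (DTensorClass.mk (fun i : Fin 4 → Fin 2 => (ind (i 0 = i 1) : F))))
      (DTensorClass.asymptoticSpectrumDTensors F 2 ∩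
        {φ | φ (DTensorClass.mk (tetra F 2)) =
          asympRankOf (fun x y : DTensorClass F 4 => x ≤ y) (DTensorClass.mk (tetra F 2))}) φ₁) :
    omegaRect F 2 1 2 + omegaTetra F ≤ 2 * omegaSix F (1 / 2) ↔
      Real.logb 2 (φ₁ (DTensorClass.mk (fun i : Fin 4 → Fin 2 => (ind (i 0 = i 1) : F)))) ≤
        omegaTetra F - omegaRect F 2 1 2 := by
  have hT₁ := (spectrum_tetra_eq_asympRank_iff F le_rfl h₁.1).1 h₁.2
  rw [midTight_iff_exists_tetraMax_sight_le_excess F]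
  constructor
  · rintro ⟨φ, hφ, hsum, hp⟩
    have hφface : φ ∈ DTensorClass.asymptoticSpectrumDTensors F 2 ∩
        {φ | φ (DTensorClass.mk (tetra F 2)) =
          asympRankOf (fun x y : DTensorClass F 4 => x ≤ y) (DTensorClass.mk (tetra F 2))} :=
      ⟨hφ, (spectrum_tetra_eq_asympRank_iff F le_rfl hφ).2 hsum⟩
    have hle : φ₁ (DTensorClass.mk (fun i : Fin 4 → Fin 2 => (ind (i 0 = i 1) : F))) ≤
        φ (DTensorClass.mk (fun i : Fin 4 → Fin 2 => (ind (i 0 = i 1) : F))) := hmin hφface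
    have h1 : 1 ≤ φ₁ (DTensorClass.mk (fun i : Fin 4 → Fin 2 => (ind (i 0 = i 1) : F))) :=
      one_le_spectrum_pair (by norm_num) h₁.1
    have hlog := Real.logb_le_logb_of_le one_lt_two (by linarith) hle
    linarith
  · intro hp₁
    exact ⟨φ₁, h₁.1, hT₁, hp₁⟩

/-- **THE LEAF `⟺` THE MINIMAL SIGHT ON THE TETRAHEDRON FACE IS 0** (at any minimiser `φ₁`): `T ≤ ψ` iff some
tetrahedron-maximal point is blind (`EdgePencilExponentConstancy`: the maximum of `p + d` is attained on `p = 0`).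
[cite: Strassen1988, Thm. 3.8] -/
theorem excessZero_iff_minSight_eq_zero {φ₁ : DTensorClass F 4 → ℝ}
    (h₁ : φ₁ ∈ DTensorClass.asymptoticSpectrumDTensors F 2 ∩
      {φ | φ (DTensorClass.mk (tetra F 2)) =
        asympRankOf (fun x y : DTensorClass F 4 => x ≤ y) (DTensorClass.mk (tetra F 2))})
    (hmin : IsMinOn
      (fun φ : DTensorClass F 4 → ℝ => φ (DTensorClass.mk (fun i : Fin 4 → Fin 2 => (ind (i 0 = i 1) : F))))
      (DTensorClass.asymptoticSpectrumDTensors F 2 ∩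
        {φ | φ (DTensorClass.mk (tetra F 2)) =
          asympRankOf (fun x y : DTensorClass F 4 => x ≤ y) (DTensorClass.mk (tetra F 2))}) φ₁) :
    omegaTetra F ≤ omegaRect F 2 1 2 ↔
      Real.logb 2 (φ₁ (DTensorClass.mk (fun i : Fin 4 → Fin 2 => (ind (i 0 = i 1) : F)))) = 0 := by
  have hT₁ := (spectrum_tetra_eq_asympRank_iff F le_rfl h₁.1).1 h₁.2
  obtain ⟨hp₁0, -⟩ := coord_pair_mem h₁.1
  constructor
  · intro hA
    -- under the leaf a tetrahedron-maximal point has `p + d = T ≤ ψ`, `d ≤ ψ`; a diamond-maximal point `φ` is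
    -- then tetrahedron-maximal (`d_φ = ψ ≥ T ≥ p_φ + d_φ`) with `p_φ = 0`, and minimality gives `p_{φ₁} ≤ p_φ = 0`.
    obtain ⟨φ, hφ, hd⟩ := exists_coord_diamond_eq_omegaRect F
    obtain ⟨hp0, -⟩ := coord_pair_mem hφ
    have hsum := coord_sum_le_omegaTetra F hφ
    have hp : Real.logb 2 (φ (DTensorClass.mk (fun i : Fin 4 → Fin 2 => (ind (i 0 = i 1) : F)))) = 0 := by
      linarith
    have hTφ : Real.logb 2 (φ (DTensorClass.mk (fun i : Fin 4 → Fin 2 => (ind (i 0 = i 1) : F)))) +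
        Real.logb 2 (φ (DTensorClass.mk (sixTetra F 2 1))) = omegaTetra F := by
      refine le_antisymm hsum ?_
      linarith
    have hφface : φ ∈ DTensorClass.asymptoticSpectrumDTensors F 2 ∩
        {φ | φ (DTensorClass.mk (tetra F 2)) =
          asympRankOf (fun x y : DTensorClass F 4 => x ≤ y) (DTensorClass.mk (tetra F 2))} :=
      ⟨hφ, (spectrum_tetra_eq_asympRank_iff F le_rfl hφ).2 hTφ⟩
    have hle : φ₁ (DTensorClass.mk (fun i : Fin 4 → Fin 2 => (ind (i 0 = i 1) : F))) ≤
        φ (DTensorClass.mk (fun i : Fin 4 → Fin 2 => (ind (i 0 = i 1) : F))) := hmin hφface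
    have h1 : 1 ≤ φ₁ (DTensorClass.mk (fun i : Fin 4 → Fin 2 => (ind (i 0 = i 1) : F))) :=
      one_le_spectrum_pair (by norm_num) h₁.1
    have hlog := Real.logb_le_logb_of_le one_lt_two (by linarith) hle
    rw [hp] at hlog
    exact le_antisymm hlog hp₁0
  · intro hp₁
    have hd₁ := (coord_diamond_mem F h₁.1).2
    linarith

/-- **A TETRAHEDRON-MAXIMAL POINT PROPS THE LADDER FROM THE TOP END**: `T − (1 − log_n e)·p_φ ≤ χ(log_n e)`
(`2 ≤ n`, `1 ≤ e ≤ n`; `d_φ + (log_n e) p_φ ≤ χ` with `d_φ = T − p_φ`), so the minimal sight on `F[T(K₄)_2]` is the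
best top-end support slope. [cite: Strassen1988, Thm. 3.8] -/
theorem omegaTetra_sub_le_omegaSix_of_tetraMax {n e : ℕ} (hn : 2 ≤ n) (he1 : 1 ≤ e) (he : e ≤ n)
    {φ : DTensorClass F 4 → ℝ} (hφ : φ ∈ DTensorClass.asymptoticSpectrumDTensors F 2)
    (hT : Real.logb 2 (φ (DTensorClass.mk (fun i : Fin 4 → Fin 2 => (ind (i 0 = i 1) : F)))) +
      Real.logb 2 (φ (DTensorClass.mk (sixTetra F 2 1))) = omegaTetra F) :
    omegaTetra F - (1 - Real.logb n e) *
        Real.logb 2 (φ (DTensorClass.mk (fun i : Fin 4 → Fin 2 => (ind (i 0 = i 1) : F)))) ≤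
      omegaSix F (Real.logb n e) := by
  have h := coord_le_omegaSix F hn he1 he hφ
  linarith

end Sights

/-! ## By name over `ℂ` -/

/-- **BY NAME**: at any minimiser `φ₁` of the sight on the tetrahedron face of `X₄(ℂ)`,
`TetraExcessZero ⟺ p_{φ₁} = 0` — the crux is the vanishing of ONE extremal value. [cite: Strassen1988, Thm. 3.8] -/
theorem tetraExcessZero_iff_minSight_eq_zero {φ₁ : DTensorClass ℂ 4 → ℝ}
    (h₁ : φ₁ ∈ DTensorClass.asymptoticSpectrumDTensors ℂ 2 ∩
      {φ | φ (DTensorClass.mk (tetra ℂ 2)) =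
        asympRankOf (fun x y : DTensorClass ℂ 4 => x ≤ y) (DTensorClass.mk (tetra ℂ 2))})
    (hmin : IsMinOn
      (fun φ : DTensorClass ℂ 4 → ℝ => φ (DTensorClass.mk (fun i : Fin 4 → Fin 2 => (ind (i 0 = i 1) : ℂ))))
      (DTensorClass.asymptoticSpectrumDTensors ℂ 2 ∩
        {φ | φ (DTensorClass.mk (tetra ℂ 2)) =
          asympRankOf (fun x y : DTensorClass ℂ 4 => x ≤ y) (DTensorClass.mk (tetra ℂ 2))}) φ₁) :
    TetraExcessZero ↔
      Real.logb 2 (φ₁ (DTensorClass.mk (fun i : Fin 4 → Fin 2 => (ind (i 0 = i 1) : ℂ)))) = 0 :=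
  excessZero_iff_minSight_eq_zero ℂ h₁ hmin

/-- **BY NAME**: at any maximiser `φ₀` of the sight on the diamond face of `X₄(ℂ)`, `TetraExcessZero ⟺
(p_{φ₀} = 0 ∧ MidTight)` — the line `blind_and_chord` with its first stub read at one point. [cite: LottiRomani1983, §2 (p. 174)] -/
theorem tetraExcessZero_iff_maxSight_eq_zero_and_midTight {φ₀ : DTensorClass ℂ 4 → ℝ}
    (h₀ : φ₀ ∈ DTensorClass.asymptoticSpectrumDTensors ℂ 2 ∩
      {φ | φ (DTensorClass.mk (sixTetra ℂ 2 1)) =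
        asympRankOf (fun x y : DTensorClass ℂ 4 => x ≤ y) (DTensorClass.mk (sixTetra ℂ 2 1))})
    (hmax : IsMaxOn
      (fun φ : DTensorClass ℂ 4 → ℝ => φ (DTensorClass.mk (fun i : Fin 4 → Fin 2 => (ind (i 0 = i 1) : ℂ))))
      (DTensorClass.asymptoticSpectrumDTensors ℂ 2 ∩
        {φ | φ (DTensorClass.mk (sixTetra ℂ 2 1)) =
          asympRankOf (fun x y : DTensorClass ℂ 4 => x ≤ y) (DTensorClass.mk (sixTetra ℂ 2 1))}) φ₀) :
    TetraExcessZero ↔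
      Real.logb 2 (φ₀ (DTensorClass.mk (fun i : Fin 4 → Fin 2 => (ind (i 0 = i 1) : ℂ)))) = 0 ∧
        omegaRect ℂ 2 1 2 + omegaTetra ℂ ≤ 2 * omegaSix ℂ (1 / 2) := by
  rw [tetraExcessZero_iff_dMaxBlind_and_midTight, dMaxBlind_iff_maxSight_eq_zero ℂ h₀ hmax]

end Summit.MatrixMultiplication.MatrixMultiplication.Theorems.EdgePencil

end
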